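import Literature.NumberTheory.EllipticCurves.ZpExtensionRankTransportProofs
import Literature.NumberTheory.EllipticCurves.ZpExtensionAnticyclotomicProofs
import Literature.NumberTheory.GaloisRepresentations.GlobalReciprocityExistenceProofs
import HarnessLib

/-!
# The anticyclotomic `ℤ_p`-extension of an imaginary quadratic field exists:
# `exists_isAnticyclotomic_holds`

Topic `NumberTheory/EllipticCurves` (Iwasawa theory of `ℤ_p`-extensions); namespace
`Literature.NumberTheory.EllipticCurves.ZpExtension`.  Proofs only: no definition, no named fact.

This file discharges the named fact
`Literature.NumberTheory.EllipticCurves.ZpExtension.exists_isAnticyclotomic` (`ZpExtension.lean`):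
for an imaginary quadratic field `K` (`[K : ℚ] = 2`, every infinite place complex) and every prime
`p` there is a `ℤ_p`-extension `κ : Γ_K ↠ ℤ_p` on which every lift of the non-trivial automorphism
of `K/ℚ` acts by `-1` (`ZpExtension.IsAnticyclotomic`) — Greenberg, LNM 1716, §1 ("the
anti-cyclotomic `ℤ_p`-extension of an imaginary quadratic field"); Washington, *Introduction to
Cyclotomic Fields*, §13.1 and Thm. 13.4 (`Gal(K̃/K) ≃ ℤ_p^{r₂+1} = ℤ_p²`, Leopoldt's defect being
`0` in unit rank `0`), the `(-1)`-eigenspace of complex conjugation.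

The published proof, as assembled in the tree:

1. **`ℤ_p`-ranks (class field theory).**  `zpRank_eq_nrComplexPlaces_add_one K p`
   (`Hom_cont(Γ_K, ℤ_p)` free of rank `r₂ + 1` with a jointly surjective basis, for `K` of unit
   rank `0`) holds for `ℚ` unconditionally (`zpRank_eq_nrComplexPlaces_add_one_rat`, from the
   Kronecker–Weber theorem `GaloisRepresentations.KroneckerWeber_holds`) and for every number field
   in every universe as soon as the global reciprocity law holds for the imaginary quadratic fields
   in `Type` (`zpRank_eq_nrComplexPlaces_add_one_of_globalReciprocity₀`, Washington's proof of
   Thm. 13.4: `Ē → ∏_{v∣p} U_v → Gal(M/K) → Cl`, file `ZpExtensionRankGlobalReciprocityProofs`, plus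
   the universe transport of `ZpExtensionRankTransportProofs`).  The global reciprocity law is now
   the theorem `GaloisRepresentations.exists_isGlobalReciprocityMap_holds` (Neukirch, *Class Field
   Theory — The Bonn Lectures*, III (6.6), (7.7), (7.8), (7.12); file
   `GlobalReciprocityExistenceProofs`).
2. **Index-two descent (Galois theory).**  `exists_isAnticyclotomic_of_zpRank_facts`
   (`ZpExtensionAnticyclotomicProofs`): a complex conjugation `c ∈ Γ_ℚ ∖ Γ_K`, the index-two glue,
   rank `≤ 1` over `ℚ` for the `c`-invariant characters and rank `2` over `K` yield a surjective
   `(-1)`-eigencharacter.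

## Main statement

* `ZpExtension.exists_isAnticyclotomic_holds : exists_isAnticyclotomic` (for `K : Type u`,
  `p` prime; unconditional).

## References

* [GreenbergLNM1716] R. Greenberg, *Iwasawa theory for elliptic curves*, LNM 1716 (1999), §1.
* [Washington1997] L. C. Washington, *Introduction to Cyclotomic Fields*, 2nd ed., GTM 83 (1997),
  §13.1, Thm. 13.4 (pp. 264–266); Ch. 14, Thm. 14.1.
* [Neukirch2013] J. Neukirch, *Class Field Theory — The Bonn Lectures*, Springer 2013, Part III
  Thm. (7.12).
* [Greenberg1987] R. Greenberg, in *Analytic number theory and Diophantine problems*, Progr. Math.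
  70 (1987), §2.
-/

noncomputable section

namespace Literature.NumberTheory.EllipticCurves

namespace ZpExtension

universe u

variable {K : Type u} [Field K] {p : ℕ} [Fact p.Prime]

/-- **Existence of the anticyclotomic `ℤ_p`-extension of an imaginary quadratic field**
(discharge of the named fact `exists_isAnticyclotomic`): for `K` imaginary quadratic and `p`
prime there is `κ : ZpExtension K p` with `κ.IsAnticyclotomic`.  Proof: the `ℤ_p`-rank statements
for `ℚ` (`zpRank_eq_nrComplexPlaces_add_one_rat`, Kronecker–Weber) and for `K`
(`zpRank_eq_nrComplexPlaces_add_one_of_globalReciprocity₀` fed with the global reciprocity law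
`GaloisRepresentations.exists_isGlobalReciprocityMap_holds` for number fields in `Type`), assembled
by the index-two descent `exists_isAnticyclotomic_of_zpRank_facts`.
Ref: Greenberg, LNM 1716 (1999), §1; Washington, *Introduction to Cyclotomic Fields*, §13.1 and
Thm. 13.4. [cite: Washington1997, Thm. 13.4] [cite: GreenbergLNM1716, §1] -/
theorem exists_isAnticyclotomic_holds : exists_isAnticyclotomic (K := K) (p := p) := by
  intro _ hK himag
  exact exists_isAnticyclotomic_of_zpRank_facts (zpRank_eq_nrComplexPlaces_add_one_rat p)
    (zpRank_eq_nrComplexPlaces_add_one_of_globalReciprocity₀ fun K₀ _ _ _ _ =>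
      GaloisRepresentations.exists_isGlobalReciprocityMap_holds K₀) hK himag

end ZpExtension

end Literature.NumberTheory.EllipticCurves
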